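import Literature.MeasureTheory.Group.LocalFieldLinearJacobian
import HarnessLib

/-!
# Linear subspaces of trivialisable spaces are trivialisable (continuous coordinates on `F`-subspaces)

Topic `Literature/MeasureTheory/Group`; namespace `Literature.MeasureTheory.Group`; companion of ★ `LocalFieldLinearJacobian` (C6).
THEOREMS ONLY; imports ★ C6 + HarnessLib.  Cell `pub/hodgecm-mathlib`, crux H413 = `stmt-HodgeConjecture-24833` (lane `--supports`,
count-neutral): brick (C6b) for the ROAD «JAC-ELL» (LH5-p02 (g6)) — its consumer C8 works on the Lie algebra `𝔤 = 𝔲(J) ⊂ M₃(K)`, an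
`F`-SUBSPACE (`F = L⁺_v ⊂ K = L_w`) with the subspace topology, «trivialised by finitely many matrix-entry coordinates»; this file
turns any continuous linear trivialisation of the AMBIENT space `E ≅ κ → F` into one of every `F`-subspace `p ⊆ E`, supplies
the closedness ∕ local compactness of `p`, and restates C6's `ν (L S) = mod_F(det L) · ν S` directly on `p`.  Seat LH10-p01 (g6),
2026-09-02.  HONEST LABEL: HC_CM is proved only modulo the 7 printed citations (2 remaining: hLiu418 = `stmt-HodgeConjecture-24832`,
h413 = `stmt-HodgeConjecture-24833`) until rung 0 closes; this file closes no organ.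

* `continuous_linearMap_of_trivialization` — every linear functional on `E ≅ κ → F` is continuous;
* `continuous_coord_of_trivialization` — every coordinate of every basis of a subspace `p ⊆ E` is continuous (the functional extends to
  `E`, Mathlib `LinearMap.exists_extend`);
* `nonempty_continuousLinearEquiv_of_trivialization`, `exists_continuousLinearEquiv_of_basis_of_trivialization` — **`p ≃L[F] (ι → F)`**;
* `isClosed_submodule_of_trivialization`, `locallyCompactSpace_submodule_of_trivialization` (`F` Hausdorff, resp. + locally compact);
* `addHaar_image_continuousLinearEquiv_submodule`, `addEquivAddHaarChar_continuousLinearEquiv_submodule` — C6 §4 on `p`.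

(Weil, Ch. I §2, Cor. 1 of Thm. 3: a finite-dimensional vector space over a non-discrete locally compact field carries a unique Hausdorff
vector-space topology, for which all linear maps are continuous and all subspaces closed — here in the special case where a trivialisation
of the ambient space is GIVEN, which needs no non-discreteness.)

## References
* [WeilBNT1967] A. Weil, *Basic Number Theory* (1967), Ch. I §2, Cor. 1 of Thm. 3.
-/

set_option autoImplicit false

noncomputable section

open MeasureTheory MeasureTheory.Measure Set
open scoped ENNReal NNReal

namespace Literature.MeasureTheory.Group

section Subspace

variable {F : Type*} [Field F] [TopologicalSpace F] [IsTopologicalRing F]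
  {κ : Type*} [Fintype κ]
  {E : Type*} [AddCommGroup E] [Module F E] [TopologicalSpace E] [IsTopologicalAddGroup E] [ContinuousSMul F E]

omit [IsTopologicalRing F] [IsTopologicalAddGroup E] [ContinuousSMul F E] in
/-- **Linear maps out of a trivialisable space are continuous**: if `E ≅ κ → F` bi-continuously and linearly (`κ` finite), every
linear map from `E` to a topological `F`-module with continuous operations is continuous (in particular every linear functional and
every linear endomorphism of `E`). [cite: WeilBNT1967, Ch. I §2 Cor. 1 of Thm. 3] -/
theorem continuous_linearMap_of_trivialization (eE : E ≃L[F] (κ → F)) {M : Type*} [AddCommGroup M] [Module F M]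
    [TopologicalSpace M] [ContinuousAdd M] [ContinuousSMul F M] (g : E →ₗ[F] M) : Continuous g := by
  have h : (g : E → M) = (g.comp (eE.symm : (κ → F) →L[F] E).toLinearMap) ∘ eE := by
    funext x
    simp
  rw [h]
  exact (LinearMap.continuous_on_pi _).comp eE.continuous

omit [IsTopologicalRing F] in
/-- **Every linear automorphism of a trivialisable space is bi-continuous**: it is the underlying linear equivalence of a
continuous linear equivalence (so consumers may feed a bare `LinearEquiv`). [cite: WeilBNT1967, Ch. I §2 Cor. 1 of Thm. 3] -/
theorem exists_continuousLinearEquiv_eq_of_trivialization (eE : E ≃L[F] (κ → F)) (L : E ≃ₗ[F] E) :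
    ∃ Lc : E ≃L[F] E, Lc.toLinearEquiv = L :=
  ⟨ContinuousLinearEquiv.mk L (continuous_linearMap_of_trivialization eE L.toLinearMap)
    (continuous_linearMap_of_trivialization eE L.symm.toLinearMap), rfl⟩

omit [IsTopologicalAddGroup E] [ContinuousSMul F E] in
/-- **Coordinates on a subspace are continuous**: for an `F`-subspace `p` of a trivialisable space `E ≅ κ → F` (subspace topology)
and ANY basis `b` of `p`, each coordinate `b.coord i : p → F` is continuous (it extends to a linear functional on `E`, Mathlib
`LinearMap.exists_extend`). [cite: WeilBNT1967, Ch. I §2 Cor. 1 of Thm. 3] -/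
theorem continuous_coord_of_trivialization (eE : E ≃L[F] (κ → F)) (p : Submodule F E) {ι : Type*}
    (b : Module.Basis ι F p) (i : ι) : Continuous (b.coord i) := by
  obtain ⟨g, hg⟩ := LinearMap.exists_extend (b.coord i)
  have h : (b.coord i : p → F) = g ∘ p.subtype := by
    rw [← hg]
    rfl
  rw [h]
  exact (continuous_linearMap_of_trivialization eE g).comp continuous_subtype_val

/-- **LINEAR SUBSPACES OF TRIVIALISABLE SPACES ARE TRIVIALISABLE**: an `F`-subspace `p` of `E ≅ κ → F` (subspace topology) is itself
bi-continuously isomorphic to `Fin (finrank p) → F` — the trivialisation `e : p ≃L[F] (ι → F)` that ★ `LocalFieldLinearJacobian` §4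
(`addEquivAddHaarChar_continuousLinearEquiv_of_trivialization`, `addHaar_image_continuousLinearEquiv_of_trivialization`) asks for,
e.g. for a Lie algebra `𝔤 ⊂ M_n(K)` cut out by linear equations over `F ⊆ K`. [cite: WeilBNT1967, Ch. I §2 Cor. 1 of Thm. 3] -/
theorem nonempty_continuousLinearEquiv_of_trivialization (eE : E ≃L[F] (κ → F)) (p : Submodule F E) :
    Nonempty (p ≃L[F] (Fin (Module.finrank F p) → F)) := by
  haveI : FiniteDimensional F E := LinearEquiv.finiteDimensional eE.toLinearEquiv.symm
  obtain ⟨e, -⟩ := exists_continuousLinearEquiv_of_basis (Module.finBasis F p)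
    (continuous_coord_of_trivialization eE p (Module.finBasis F p))
  exact ⟨e⟩

/-- The same for any basis indexed by any finite type: `p ≃L[F] (ι → F)` extending `b.equivFun`. [cite: WeilBNT1967, Ch. I §2 Cor. 1 of Thm. 3] -/
theorem exists_continuousLinearEquiv_of_basis_of_trivialization (eE : E ≃L[F] (κ → F)) (p : Submodule F E)
    {ι : Type*} [Fintype ι] (b : Module.Basis ι F p) :
    ∃ e : p ≃L[F] (ι → F), e.toLinearEquiv = b.equivFun :=
  exists_continuousLinearEquiv_of_basis b (continuous_coord_of_trivialization eE p b)

/-- **Every linear automorphism of a subspace of a trivialisable space is bi-continuous.** [cite: WeilBNT1967, Ch. I §2 Cor. 1 of Thm. 3] -/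
theorem exists_continuousLinearEquiv_eq_submodule (eE : E ≃L[F] (κ → F)) (p : Submodule F E) (L : p ≃ₗ[F] p) :
    ∃ Lc : p ≃L[F] p, Lc.toLinearEquiv = L := by
  obtain ⟨e⟩ := nonempty_continuousLinearEquiv_of_trivialization eE p
  exact exists_continuousLinearEquiv_eq_of_trivialization e L

omit [IsTopologicalAddGroup E] [ContinuousSMul F E] in
/-- **A subspace of a trivialisable space over a Hausdorff field is closed** (it is the kernel of a continuous linear projection).
[cite: WeilBNT1967, Ch. I §2 Cor. 1 of Thm. 3] -/
theorem isClosed_submodule_of_trivialization [T2Space F] (eE : E ≃L[F] (κ → F)) (p : Submodule F E) :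
    IsClosed (p : Set E) := by
  haveI : T2Space E := eE.toHomeomorph.symm.t2Space
  obtain ⟨q, hq⟩ := p.exists_isCompl
  -- the projection onto `q` along `p` is a continuous linear map with kernel `p`
  set π : E →ₗ[F] E := q.subtype.comp (Submodule.projectionOnto q p hq.symm) with hπ
  have hker : (p : Set E) = π ⁻¹' {0} := by
    ext x
    rw [SetLike.mem_coe, Set.mem_preimage, Set.mem_singleton_iff, hπ, LinearMap.comp_apply, Submodule.subtype_apply,
      ZeroMemClass.coe_eq_zero, Submodule.projectionOnto_apply_eq_zero_iff]
  have hπc : Continuous π := by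
    -- `π = eE⁻¹ ∘ (eE ∘ π ∘ eE⁻¹) ∘ eE`, the middle map being a linear endomorphism of `κ → F`
    have h : (π : E → E) = eE.symm ∘ ((eE : E →L[F] (κ → F)).toLinearMap.comp (π.comp (eE.symm : (κ → F) →L[F] E).toLinearMap)) ∘ eE := by
      funext x
      simp
    rw [h]
    exact eE.symm.continuous.comp ((LinearMap.continuous_on_pi _).comp eE.continuous)
  rw [hker]
  exact isClosed_singleton.preimage hπc

omit [IsTopologicalAddGroup E] [ContinuousSMul F E] in
/-- Hence a subspace of a trivialisable space over a locally compact Hausdorff field is locally compact (subspace topology) — the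
`[LocallyCompactSpace V]` instance ★ `LocalFieldLinearJacobian` §4 takes. [cite: WeilBNT1967, Ch. I §2 Cor. 1 of Thm. 3] -/
theorem locallyCompactSpace_submodule_of_trivialization [T2Space F] [LocallyCompactSpace F] (eE : E ≃L[F] (κ → F))
    (p : Submodule F E) : LocallyCompactSpace p := by
  haveI : LocallyCompactSpace E := eE.toHomeomorph.isClosedEmbedding.locallyCompactSpace
  exact (isClosed_submodule_of_trivialization eE p).isClosedEmbedding_subtypeVal.locallyCompactSpace

end Subspace

section Measure

variable {F : Type*} [Field F] [TopologicalSpace F] [IsTopologicalRing F] [LocallyCompactSpace F]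
  [SecondCountableTopology F] [MeasurableSpace F] [BorelSpace F]
  {κ : Type*} [Fintype κ]
  {E : Type*} [AddCommGroup E] [Module F E] [TopologicalSpace E] [IsTopologicalAddGroup E] [ContinuousSMul F E]
  [MeasurableSpace E] [BorelSpace E]

/-- **`ν (L S) = mod_F(det L) · ν S` on a linear subspace** `p ⊆ E ≅ κ → F` (subspace topology, Borel structure induced from `E`):
for every regular Haar measure `ν` of `p` and every continuous linear automorphism `L` of `p` — ★ `LocalFieldLinearJacobian` §4 with the
trivialisation and local compactness supplied by this file. [cite: WeilBNT1967, Ch. I §2] -/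
theorem addHaar_image_continuousLinearEquiv_submodule (eE : E ≃L[F] (κ → F)) (p : Submodule F E)
    [LocallyCompactSpace p] (ν : Measure p) [ν.IsAddHaarMeasure] [ν.Regular] (L : p ≃L[F] p) (s : Set p) :
    ν (L '' s) = distribHaarChar F (LinearEquiv.det L.toLinearEquiv) * ν s := by
  classical
  obtain ⟨e⟩ := nonempty_continuousLinearEquiv_of_trivialization eE p
  exact addHaar_image_continuousLinearEquiv_of_trivialization ν e L s

/-- The Haar-character form on a linear subspace: `χ(L) = mod_F(det L)`. [cite: WeilBNT1967, Ch. I §2] -/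
theorem addEquivAddHaarChar_continuousLinearEquiv_submodule (eE : E ≃L[F] (κ → F)) (p : Submodule F E)
    [LocallyCompactSpace p] (L : p ≃L[F] p) :
    addEquivAddHaarChar L.toContinuousAddEquiv = distribHaarChar F (LinearEquiv.det L.toLinearEquiv) := by
  classical
  obtain ⟨e⟩ := nonempty_continuousLinearEquiv_of_trivialization eE p
  exact addEquivAddHaarChar_continuousLinearEquiv_of_trivialization e L

/-- **`ν (L S) = mod_F(det L) · ν S` for a bare linear automorphism `L` of a subspace** `p ⊆ E ≅ κ → F` (continuity is automatic).
[cite: WeilBNT1967, Ch. I §2] -/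
theorem addHaar_image_linearEquiv_submodule (eE : E ≃L[F] (κ → F)) (p : Submodule F E)
    [LocallyCompactSpace p] (ν : Measure p) [ν.IsAddHaarMeasure] [ν.Regular] (L : p ≃ₗ[F] p) (s : Set p) :
    ν (L '' s) = distribHaarChar F (LinearEquiv.det L) * ν s := by
  obtain ⟨Lc, hLc⟩ := exists_continuousLinearEquiv_eq_submodule eE p L
  have hfun : (L : p → p) = (Lc : p → p) := by rw [← hLc]; rfl
  rw [hfun, addHaar_image_continuousLinearEquiv_submodule eE p ν Lc s, hLc]

/-- **`ν (L⁻¹ S) = mod_F(det L)⁻¹ · ν S`** for a bare linear automorphism `L` of a subspace `p ⊆ E ≅ κ → F`. [cite: WeilBNT1967, Ch. I §2] -/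
theorem addHaar_preimage_linearEquiv_submodule (eE : E ≃L[F] (κ → F)) (p : Submodule F E)
    [LocallyCompactSpace p] (ν : Measure p) [ν.IsAddHaarMeasure] [ν.Regular] (L : p ≃ₗ[F] p) (s : Set p) :
    ν (L ⁻¹' s) = (distribHaarChar F (LinearEquiv.det L))⁻¹ * ν s := by
  have hpre : (L : p → p) ⁻¹' s = L.symm '' s := (L.toEquiv.image_symm_eq_preimage s).symm
  rw [hpre, addHaar_image_linearEquiv_submodule eE p ν L.symm s, LinearEquiv.det_symm,
    map_inv (LinearEquiv.det : (p ≃ₗ[F] p) →* Fˣ) L,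
    map_inv (distribHaarChar F) (LinearEquiv.det L), ENNReal.coe_inv (distribHaarChar_pos).ne']

/-- **`ν (L S) = mod_F(det L) · ν S` for a bare linear automorphism of a trivialisable space `E ≅ κ → F`** carrying any Borel structure
and any regular Haar measure `ν`. [cite: WeilBNT1967, Ch. I §2] -/
theorem addHaar_image_linearEquiv_of_trivialization [LocallyCompactSpace E] (eE : E ≃L[F] (κ → F))
    (ν : Measure E) [ν.IsAddHaarMeasure] [ν.Regular] (L : E ≃ₗ[F] E) (s : Set E) :
    ν (L '' s) = distribHaarChar F (LinearEquiv.det L) * ν s := by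
  classical
  obtain ⟨Lc, hLc⟩ := exists_continuousLinearEquiv_eq_of_trivialization eE L
  have hfun : (L : E → E) = (Lc : E → E) := by rw [← hLc]; rfl
  rw [hfun, addHaar_image_continuousLinearEquiv_of_trivialization ν eE Lc s, hLc]

end Measure

end Literature.MeasureTheory.Group

end
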